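import Mathlib
import Literature.NumberTheory.Irrationality.LaiSprangZudilin2026.LeadingCoefficient
import HarnessLib

/-!
# Lai–Sprang–Zudilin 2026, Lemma 4.1: the creative-telescoping certificate for `R_n(t)` (PROVED)

Topic `Literature/NumberTheory/Irrationality/LaiSprangZudilin2026`.  Source: L. Lai, J. Sprang, W. Zudilin,
*A note on the irrationality of `ζ₂(5)`*, IMRN **2026**:16, rnag180 = arXiv:2505.05005 [LaiSprangZudilin2026],
§§3–4 (held text `paper:arxiv-2505.05005`, pp. 5–7, read on the page).  Everything here is PROVED.

## Source, as printed

* Definition 3.1: `R_n(t) = 2^{8n}(2t+n)(t+½)_n⁴/(t)_{n+1}⁴`.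
* **Lemma 4.1.** «For `n ∈ ℤ_{>0}`, let
  `T_n(t) = 16(8(2n+1)t⁴ + [48]n(2n+1)t³ + 2(2n+1)(48n²−6n−5)t² + 2(80n⁴+16n³−28n²−3n+3)t + (48n⁵−24n³+3n²+4n−1))
  · 2^{8n}(t−½)_n⁴/(t)_{n+1}⁴`.  Then
  `(n+1)⁵R_{n+1}(t) − 32(2n+1)(8n⁴+16n³+20n²+12n+3)R_n(t) + 2¹⁶n⁵R_{n−1}(t) = T_n(t+1) − T_n(t)`.
  Proof. Dividing both sides by `2^{8(n+1)}(t+½)_n⁴/(t)_{n+1}⁴` and clearing the denominators … reduce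
  verification … to a linear-algebra check of identity between two polynomials of degree at most 12 in `t` and at
  most 14 in `n`.» («With the help of Zeilberger's algorithm of creative telescoping».)

TRANSCRIPTION NOTE (kernel-settled).  The held arXiv text (v2 = accepted author version) prints the `t³`
coefficient of the certificate polynomial as `768n(2n+1)`.  With that coefficient the identity is FALSE (already at
`n = 1`); the identity holds — for every `n ≥ 1`, as proved below — with `48n(2n+1)` (note `768 = 16·48`: the
outer factor `16` was apparently absorbed twice in typesetting).  `certPoly` carries the corrected coefficient; all
other coefficients are verbatim.  The certificate is uniquely determined by the ansatz
`T_n = 16·(quartic in t)·2^{8n}(t−½)_n⁴/(t)_{n+1}⁴`, so this is a correction of a misprint, not a different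
certificate.

## What is formalised (PROVED, no facts)

`R n t` (Definition 3.1, over `ℚ`), `certPoly`, `T n t`, the peeling lemmas for the Pochhammer products, and
**`lemma41`**: the telescoping identity for every `n ≥ 1` and every rational `t` off the poles `0, −1, …, −(n+1)`.
Not covered: the partial fractions of `R_n`, Lemma 4.2 (a) (recursions for `ρ_{n,0}`, `ρ_{n,3}`), the
2-adic integrals.  Companion files: `LeadingCoefficient.lean` (`recMid`, the typed Lemma 5.2), `SecondSolution.lean`.
-/

namespace Literature.NumberTheory.Irrationality.LaiSprangZudilin2026

open Finset

/-- `R_n(t) = 2^{8n}(2t+n)(t+½)_n⁴/(t)_{n+1}⁴` (Definition 3.1), as a function `ℚ → ℚ` (junk value `0` at the poles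
`t = 0, −1, …, −n`). [cite: LaiSprangZudilin2026, Definition 3.1] -/
def R (n : ℕ) (t : ℚ) : ℚ :=
  2 ^ (8 * n) * (2 * t + n) * (∏ j ∈ range n, (t + 1 / 2 + j)) ^ 4 / (∏ j ∈ range (n + 1), (t + j)) ^ 4

/-- The quartic of the certificate `T_n` (with the corrected `t³` coefficient `48n(2n+1)`, see the module
docstring): `8(2n+1)t⁴ + 48n(2n+1)t³ + 2(2n+1)(48n²−6n−5)t² + 2(80n⁴+16n³−28n²−3n+3)t + (48n⁵−24n³+3n²+4n−1)`.
[cite: LaiSprangZudilin2026, Lemma 4.1 (display for `T_n(t)`)] -/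
def certPoly (n t : ℚ) : ℚ :=
  8 * (2 * n + 1) * t ^ 4 + 48 * n * (2 * n + 1) * t ^ 3 + 2 * (2 * n + 1) * (48 * n ^ 2 - 6 * n - 5) * t ^ 2
    + 2 * (80 * n ^ 4 + 16 * n ^ 3 - 28 * n ^ 2 - 3 * n + 3) * t + (48 * n ^ 5 - 24 * n ^ 3 + 3 * n ^ 2 + 4 * n - 1)

/-- `T_n(t) = 16·certPoly·2^{8n}(t−½)_n⁴/(t)_{n+1}⁴`. [cite: LaiSprangZudilin2026, Lemma 4.1] -/
def T (n : ℕ) (t : ℚ) : ℚ :=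
  16 * certPoly n t * 2 ^ (8 * n) * (∏ j ∈ range n, (t - 1 / 2 + j)) ^ 4 / (∏ j ∈ range (n + 1), (t + j)) ^ 4

/-- `R_1(1) = 2⁸·3·(3/2)⁴/(1·2)⁴ = 243` (a sanity value of Definition 3.1). [cite: LaiSprangZudilin2026, Definition 3.1] -/
theorem R_one_one : R 1 1 = 243 := by
  norm_num [R, prod_range_succ]

/-! ## Peeling the Pochhammer products -/

/-- `(t−½)_{m+1} = (t−½)·∏_{j<m}(t+½+j)`. [cite: LaiSprangZudilin2026, Lemma 4.1 (proof: «dividing both sides by …»)] -/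
theorem prod_shift_half (m : ℕ) (t : ℚ) :
    ∏ j ∈ range (m + 1), (t - 1 / 2 + j) = (t - 1 / 2) * ∏ j ∈ range m, (t + 1 / 2 + j) := by
  rw [prod_range_succ', Nat.cast_zero, add_zero, mul_comm]
  congr 1
  exact prod_congr rfl fun j _ => by push_cast; ring

/-- `(t)_{m+1} = t·∏_{j<m}(t+1+j)`. [cite: LaiSprangZudilin2026, Lemma 4.1 (proof)] -/
theorem prod_shift_one (m : ℕ) (t : ℚ) :
    ∏ j ∈ range (m + 1), (t + j) = t * ∏ j ∈ range m, (t + 1 + j) := by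
  rw [prod_range_succ', Nat.cast_zero, add_zero, mul_comm]
  congr 1
  exact prod_congr rfl fun j _ => by push_cast; ring

/-- `(t+1−½)_{m} = (t+½)_m`. [cite: LaiSprangZudilin2026, Lemma 4.1 (proof)] -/
theorem prod_succ_sub_half (m : ℕ) (t : ℚ) :
    ∏ j ∈ range m, (t + 1 - 1 / 2 + j) = ∏ j ∈ range m, (t + 1 / 2 + j) :=
  prod_congr rfl fun j _ => by ring

/-! ## Lemma 4.1 -/

/-- **Lemma 4.1** (PROVED; the printed creative-telescoping certificate, `t³` coefficient corrected to `48n(2n+1)`):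
for `n ≥ 1` and rational `t ∉ {0, −1, …, −(n+1)}`,
`(n+1)⁵R_{n+1}(t) − 32(2n+1)(8n⁴+16n³+20n²+12n+3)R_n(t) + 2¹⁶n⁵R_{n−1}(t) = T_n(t+1) − T_n(t)`.
[cite: LaiSprangZudilin2026, Lemma 4.1] -/
theorem lemma41 {n : ℕ} (hn : 1 ≤ n) (t : ℚ) (ht : ∀ j : ℕ, j ≤ n + 1 → t + j ≠ 0) :
    ((n : ℚ) + 1) ^ 5 * R (n + 1) t - (recMid n : ℚ) * R n t + 2 ^ 16 * (n : ℚ) ^ 5 * R (n - 1) t =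
      T n (t + 1) - T n t := by
  obtain ⟨m, rfl⟩ : ∃ m, n = m + 1 := ⟨n - 1, by omega⟩
  rw [Nat.add_sub_cancel]
  -- the nonvanishing denominators
  have ht0 : t ≠ 0 := by simpa using ht 0 (by omega)
  have hE : ∏ j ∈ range m, (t + 1 + j) ≠ 0 := by
    rw [prod_ne_zero_iff]
    intro j hj
    rw [mem_range] at hj
    have := ht (j + 1) (by omega)
    push_cast at this
    intro h; apply this; linarith
  have hm1 : t + ((m : ℚ) + 1) ≠ 0 := by
    have := ht (m + 1) (by omega); push_cast at this; exact this
  have hm2 : t + ((m : ℚ) + 2) ≠ 0 := by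
    have := ht (m + 2) (by omega); push_cast at this; exact this
  -- expand every product down to `range m`
  unfold R T
  rw [show m + 1 + 1 = m + 2 from rfl, prod_succ_sub_half,
    prod_range_succ (f := fun j => t + 1 / 2 + (j : ℚ)) (n := m + 1),
    prod_range_succ (f := fun j => t + 1 / 2 + (j : ℚ)) (n := m),
    prod_range_succ (f := fun j => t + (j : ℚ)) (n := m + 2),
    prod_range_succ (f := fun j => t + (j : ℚ)) (n := m + 1), prod_shift_one m t,
    prod_range_succ (f := fun j => t + 1 + (j : ℚ)) (n := m + 1),
    prod_range_succ (f := fun j => t + 1 + (j : ℚ)) (n := m), prod_shift_half m t]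
  set A := ∏ j ∈ range m, (t + 1 / 2 + (j : ℚ)) with hAdef
  set E := ∏ j ∈ range m, (t + 1 + (j : ℚ)) with hEdef
  simp only [recMid, certPoly]
  push_cast
  have hm1' : t + 1 + (m : ℚ) ≠ 0 := by rw [show t + 1 + (m : ℚ) = t + ((m : ℚ) + 1) by ring]; exact hm1
  have hm2' : t + 1 + ((m : ℚ) + 1) ≠ 0 := by rw [show t + 1 + ((m : ℚ) + 1) = t + ((m : ℚ) + 2) by ring]; exact hm2
  field_simp
  ring

end Literature.NumberTheory.Irrationality.LaiSprangZudilin2026
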